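import Literature.Geometry.Lorentzian.KerrDeSitterSubextremalDiscriminant
import Literature.Geometry.Lorentzian.KerrDeSitterSubextremalFromRoots
import Literature.Geometry.Lorentzian.SchwarzschildDeSitterScalarModeStability
import HarnessLib

/-!
# `IsSubextremal ⇔` the printed discriminant conditions (Hintz–Petersen–Vasy (1.2) `> 0`,
# Casals–Teixeira da Costa (3.1) `< 0`) — the converse direction (theorems only)

Theorems only (no named facts, no new definitions). `KerrDeSitterSubextremalDiscriminant.lean` proves
`IsSubextremal M a Λ → 0 < D_HPV` and `→ D_CTdC < 0`. Here the CONVERSE: for `M > 0`, `Λ > 0` and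
`0 < subextremalDiscriminantHPV M a Λ` the horizon function `Δ_r` has three ordered positive simple
roots with the subextremal sign pattern, hence `IsSubextremal M a Λ` — so that the tree's standing
hypothesis and the printed one [HintzPetersenVasy2025, (1.2)] ("subextremal … if and only if the
discriminant condition holds"), equivalently [CasalsTeixeiradacosta2022, (3.1)], COINCIDE:

* `isSubextremal_iff_discriminantHPV : IsSubextremal M a Λ ↔ 0 < M ∧ 0 < Λ ∧ 0 < D_HPV`,
* `isSubextremal_iff_discriminantCTdC : IsSubextremal M a Λ ↔ 0 < M ∧ 0 < Λ ∧ D_CTdC < 0`.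

Proof (elementary, `a ≠ 0`; `a = 0` is `isSubextremal_zero_a_iff`): with `ℓ = Λ/3`, `c = 1 − ℓa²`,
`K = c² − 4Λa²`, the quadratic `Q(N) = −9ΛN² + (12cΛa² + c³)N − (1+ℓa²)⁴a²` has `Q(M²) = M²·D_HPV` and
discriminant `K³`; so `D_HPV > 0` forces `K > 0` and `c > 0`. With `s = √K`, the radii
`r_A² = (c − s)/(6ℓ) < r_B² = (c + s)/(6ℓ)` (critical points of `(r²+a²)(1−ℓr²)/(2r)`) satisfy
`Δ_r(r_X) = 2r_X(g_X − M)` with `g_A = r_A(2c+s)/3`, `g_B = r_B(2c−s)/3`,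
`M²·D_HPV = −9Λ(M² − g_A²)(M² − g_B²)` and `g_B² − g_A² = s³/(27ℓ) > 0`; hence `g_A < M < g_B`, i.e.
`Δ_r(r_A) < 0 < Δ_r(r_B)`. Three intermediate-value roots `0 < x < r_A < y < r_B < z` follow
(`Δ_r(0) = a² > 0`, `Δ_r < 0` far out); a quadratic vanishing at three points is zero, so
`Δ_r = −ℓ(r−x)(r−y)(r−z)(r+x+y+z)`, and `horizons_of_factorisation` concludes.

## References
* P. Hintz, O. Petersen, A. Vasy, arXiv:2508.06620, (1.2). [HintzPetersenVasy2025]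
* M. Casals, R. Teixeira da Costa, arXiv:2105.13329 v3, (3.1)–(3.2). [CasalsTeixeiradacosta2022]
-/

noncomputable section

open Set

namespace Literature.Geometry.Lorentzian.KerrDeSitter

section IffDiscriminant

variable {M a Λ : ℝ}

/-- `Δ_r` is continuous in `r` (a polynomial). [cite: PetersenVasy2021, (1.1)] -/
private theorem delta_continuous' (M a Λ : ℝ) : Continuous fun r => delta M a Λ r := by
  unfold delta; fun_prop

/-- The discriminant of `Q(N) = −9ΛN² + (12cΛa² + c³)N − (1+Λa²/3)⁴a²` (`c = 1 − Λa²/3`) is the cube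
`(c² − 4Λa²)³`. [cite: HintzPetersenVasy2025, (1.2)] -/
private theorem discQ_eq (Λ a : ℝ) :
    (12 * (1 - Λ * a ^ 2 / 3) * Λ * a ^ 2 + (1 - Λ * a ^ 2 / 3) ^ 3) ^ 2 -
        36 * Λ * ((1 + Λ * a ^ 2 / 3) ^ 4 * a ^ 2) =
      ((1 - Λ * a ^ 2 / 3) ^ 2 - 4 * Λ * a ^ 2) ^ 3 := by
  ring

/-- `M² · D_HPV = Q(M²)`. [cite: HintzPetersenVasy2025, (1.2)] -/
private theorem msq_mul_discriminantHPV (hM : M ≠ 0) (a Λ : ℝ) :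
    M ^ 2 * subextremalDiscriminantHPV M a Λ =
      -(9 * Λ) * (M ^ 2) ^ 2 + (12 * (1 - Λ * a ^ 2 / 3) * Λ * a ^ 2 + (1 - Λ * a ^ 2 / 3) ^ 3) * M ^ 2 -
        (1 + Λ * a ^ 2 / 3) ^ 4 * a ^ 2 := by
  unfold subextremalDiscriminantHPV
  field_simp
  ring

/-- Critical-point identity: with `ρ = (c − s)/(6ℓ)`, `3ℓρ² − cρ = (s² − c²)/(12ℓ)`.
[cite: HintzPetersenVasy2025, (1.2)] -/
private theorem crit_aux (ℓ c s : ℝ) (hℓ : ℓ ≠ 0) :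
    3 * ℓ * ((c - s) / (6 * ℓ)) ^ 2 - c * ((c - s) / (6 * ℓ)) = (s ^ 2 - c ^ 2) / (12 * ℓ) := by
  field_simp
  ring

/-- Sum, product and gap of the two squared critical values `g_A² = ρ_A(2c+s)²/9`, `g_B² = ρ_B(2c−s)²/9`
(`ρ_A = (c−s)/(6ℓ)`, `ρ_B = (c+s)/(6ℓ)`), as rational functions of `c, s, ℓ`. [cite: HintzPetersenVasy2025, (1.2)] -/
private theorem critvals_aux (ℓ c s : ℝ) (hℓ : ℓ ≠ 0) :
    (c - s) / (6 * ℓ) * (2 * c + s) ^ 2 / 9 + (c + s) / (6 * ℓ) * (2 * c - s) ^ 2 / 9 =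
        (8 * c ^ 3 - 6 * c * s ^ 2) / (54 * ℓ) ∧
      (c - s) / (6 * ℓ) * (2 * c + s) ^ 2 / 9 * ((c + s) / (6 * ℓ) * (2 * c - s) ^ 2 / 9) =
        (c ^ 2 - s ^ 2) * (4 * c ^ 2 - s ^ 2) ^ 2 / (2916 * ℓ ^ 2) ∧
      (c + s) / (6 * ℓ) * (2 * c - s) ^ 2 / 9 - (c - s) / (6 * ℓ) * (2 * c + s) ^ 2 / 9 =
        s ^ 3 / (27 * ℓ) := by
  refine ⟨?_, ?_, ?_⟩ <;> field_simp <;> ring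

/-- **The key identity** `M²·D_HPV = −9Λ(M² − g_A²)(M² − g_B²)` once `s² = c² − 4Λa²`
(`g_A² = ρ_A(2c+s)²/9`, `g_B² = ρ_B(2c−s)²/9`, `ρ_{A,B} = (c ∓ s)/(2Λ)`, `c = 1 − Λa²/3`).
[cite: HintzPetersenVasy2025, (1.2)] -/
private theorem key_aux (hM : M ≠ 0) (hΛ : Λ ≠ 0) {s : ℝ}
    (hs2 : s ^ 2 = (1 - Λ * a ^ 2 / 3) ^ 2 - 4 * Λ * a ^ 2) :
    M ^ 2 * subextremalDiscriminantHPV M a Λ =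
      -(9 * Λ) * (M ^ 2 - (1 - Λ * a ^ 2 / 3 - s) / (6 * (Λ / 3)) * (2 * (1 - Λ * a ^ 2 / 3) + s) ^ 2 / 9) *
        (M ^ 2 - (1 - Λ * a ^ 2 / 3 + s) / (6 * (Λ / 3)) * (2 * (1 - Λ * a ^ 2 / 3) - s) ^ 2 / 9) := by
  have hℓ : Λ / 3 ≠ 0 := by positivity
  obtain ⟨hsum, hprod, -⟩ := critvals_aux (Λ / 3) (1 - Λ * a ^ 2 / 3) s hℓ
  have e1 : ∀ A B : ℝ, -(9 * Λ) * (M ^ 2 - A) * (M ^ 2 - B) =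
      -(9 * Λ) * ((M ^ 2) ^ 2 - (A + B) * M ^ 2 + A * B) := fun A B => by ring
  rw [e1, hsum, hprod, hs2, msq_mul_discriminantHPV hM a Λ]
  field_simp
  ring

/-- `Δ_r` at a critical radius: if `r² = ρ` and `3ℓρ² − cρ + a² = 0` (`ℓ = Λ/3`, `c = 1 − Λa²/3`) then
`Δ_r(r) = 2ρ(c − 2ℓρ) − 2Mr`. [cite: PetersenVasy2021, (1.1)] -/
private theorem delta_at_crit {r ρ : ℝ} (hr : r ^ 2 = ρ)
    (hcrit : 3 * (Λ / 3) * ρ ^ 2 - (1 - Λ * a ^ 2 / 3) * ρ + a ^ 2 = 0) :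
    delta M a Λ r = 2 * ρ * ((1 - Λ * a ^ 2 / 3) - 2 * (Λ / 3) * ρ) - 2 * M * r := by
  have h4 : r ^ 4 = ρ ^ 2 := by rw [← hr]; ring
  have e1 : delta M a Λ r = -(Λ / 3) * r ^ 4 + (1 - Λ * a ^ 2 / 3) * r ^ 2 - 2 * M * r + a ^ 2 := by
    unfold delta; ring
  rw [e1, h4, hr]
  linear_combination hcrit

/-- A real quadratic `α r² + β r + γ` vanishing at three distinct points vanishes identically.
[cite: CasalsTeixeiradacosta2022, (3.2)] -/
private theorem quad_eq_zero_of_three_roots {α β γ x y z : ℝ} (hxy : x ≠ y) (hyz : y ≠ z) (hxz : x ≠ z)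
    (hx : α * x ^ 2 + β * x + γ = 0) (hy : α * y ^ 2 + β * y + γ = 0)
    (hz : α * z ^ 2 + β * z + γ = 0) : α = 0 ∧ β = 0 ∧ γ = 0 := by
  have h1 : α * (x + y) + β = 0 := by
    have : (x - y) * (α * (x + y) + β) = 0 := by linear_combination hx - hy
    rcases mul_eq_zero.1 this with h | h
    · exact absurd (sub_eq_zero.1 h) hxy
    · exact h
  have h2 : α * (y + z) + β = 0 := by
    have : (y - z) * (α * (y + z) + β) = 0 := by linear_combination hy - hz
    rcases mul_eq_zero.1 this with h | h
    · exact absurd (sub_eq_zero.1 h) hyz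
    · exact h
  have hα : α = 0 := by
    have : (x - z) * α = 0 := by linear_combination h1 - h2
    rcases mul_eq_zero.1 this with h | h
    · exact absurd (sub_eq_zero.1 h) hxz
    · exact h
  have hβ : β = 0 := by rw [hα] at h1; linarith
  refine ⟨hα, hβ, ?_⟩
  rw [hα, hβ] at hx; linarith

/-- **Step 1 (algebra).** For `a ≠ 0`, `M, Λ > 0` and `D_HPV > 0` there are radii `0 < r_A < r_B` with
`Δ_r(r_A) < 0 < Δ_r(r_B)`. [cite: HintzPetersenVasy2025, (1.2)] -/
theorem exists_signChange_of_discriminantHPV_pos (hM : 0 < M) (hΛ : 0 < Λ) (ha : a ≠ 0)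
    (hD : 0 < subextremalDiscriminantHPV M a Λ) :
    ∃ rA rB : ℝ, 0 < rA ∧ rA < rB ∧ delta M a Λ rA < 0 ∧ 0 < delta M a Λ rB := by
  set ℓ := Λ / 3 with hℓ
  have hℓ0 : 0 < ℓ := by positivity
  set c := 1 - Λ * a ^ 2 / 3 with hc
  set K := c ^ 2 - 4 * Λ * a ^ 2 with hK
  set β := 12 * c * Λ * a ^ 2 + c ^ 3 with hβ
  set γ := (1 + Λ * a ^ 2 / 3) ^ 4 * a ^ 2 with hγ
  have ha2 : 0 < a ^ 2 := by positivity
  -- Q(M²) = M²·D > 0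
  have hQ : 0 < -(9 * Λ) * (M ^ 2) ^ 2 + β * M ^ 2 - γ := by
    rw [hβ, hγ, ← msq_mul_discriminantHPV hM.ne' a Λ]; positivity
  -- disc(Q) = K³ > 0, hence K > 0
  have hK3 : 0 < K ^ 3 := by
    have hdisc : β ^ 2 - 36 * Λ * γ = K ^ 3 := by rw [hβ, hγ, hK, hc]; exact discQ_eq Λ a
    have e : β ^ 2 - 36 * Λ * γ = (β - 18 * Λ * M ^ 2) ^ 2 +
        36 * Λ * (-(9 * Λ) * (M ^ 2) ^ 2 + β * M ^ 2 - γ) := by ring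
    rw [← hdisc, e]; positivity
  have hKpos : 0 < K := (Odd.pow_pos_iff (by decide : Odd 3)).1 hK3
  -- c > 0 (from β·M² > 0)
  have hγ0 : 0 ≤ γ := by rw [hγ]; positivity
  have hβpos : 0 < β := by
    by_contra h
    rw [not_lt] at h
    have h1 : β * M ^ 2 ≤ 0 := mul_nonpos_of_nonpos_of_nonneg h (by positivity)
    have h2 : 0 ≤ 9 * Λ * (M ^ 2) ^ 2 := by positivity
    linarith
  have hcpos : 0 < c := by
    by_contra h
    rw [not_lt] at h
    have : c * (12 * Λ * a ^ 2 + c ^ 2) ≤ 0 := mul_nonpos_of_nonpos_of_nonneg h (by positivity)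
    have : β ≤ 0 := by rw [hβ]; linarith
    linarith
  -- s = √K ∈ (0, c)
  set s := Real.sqrt K with hs
  have hs0 : 0 < s := Real.sqrt_pos.2 hKpos
  have hs2 : s ^ 2 = K := Real.sq_sqrt hKpos.le
  have hsc : s < c := by
    have h4 : 0 < 4 * Λ * a ^ 2 := by positivity
    have : s ^ 2 < c ^ 2 := by rw [hs2, hK]; linarith
    exact lt_of_pow_lt_pow_left₀ 2 hcpos.le this
  have h2cs : 0 < 2 * c - s := by linarith
  -- critical radii
  set ρA := (c - s) / (6 * ℓ) with hρA
  set ρB := (c + s) / (6 * ℓ) with hρB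
  have hρA0 : 0 < ρA := by rw [hρA]; exact div_pos (by linarith) (by positivity)
  have hρAB : ρA < ρB := by
    rw [hρA, hρB]; exact div_lt_div_of_pos_right (by linarith) (by positivity)
  have hρB0 : 0 < ρB := hρA0.trans hρAB
  set rA := Real.sqrt ρA with hrA
  set rB := Real.sqrt ρB with hrB
  have hrA0 : 0 < rA := Real.sqrt_pos.2 hρA0
  have hrB0 : 0 < rB := Real.sqrt_pos.2 hρB0
  have hrA2 : rA ^ 2 = ρA := Real.sq_sqrt hρA0.le
  have hrB2 : rB ^ 2 = ρB := Real.sq_sqrt hρB0.le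
  have hrAB : rA < rB := Real.sqrt_lt_sqrt hρA0.le hρAB
  -- critical equations
  have hℓΛ : Λ = 3 * ℓ := by rw [hℓ]; ring
  have hcritA : 3 * ℓ * ρA ^ 2 - c * ρA + a ^ 2 = 0 := by
    have e := crit_aux ℓ c s hℓ0.ne'
    rw [← hρA] at e
    have : 3 * ℓ * ρA ^ 2 - c * ρA + a ^ 2 = (s ^ 2 - c ^ 2) / (12 * ℓ) + a ^ 2 := by rw [← e]
    rw [this, hs2, hK, hℓΛ]
    field_simp; ring
  have hcritB : 3 * ℓ * ρB ^ 2 - c * ρB + a ^ 2 = 0 := by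
    have e := crit_aux ℓ c (-s) hℓ0.ne'
    have hneg : (c - -s) / (6 * ℓ) = ρB := by rw [hρB]; ring
    rw [hneg] at e
    have : 3 * ℓ * ρB ^ 2 - c * ρB + a ^ 2 = ((-s) ^ 2 - c ^ 2) / (12 * ℓ) + a ^ 2 := by rw [← e]
    rw [this, neg_sq, hs2, hK, hℓΛ]
    field_simp; ring
  -- Δ at the critical radii
  set gA := rA * (2 * c + s) / 3 with hgA
  set gB := rB * (2 * c - s) / 3 with hgB
  have hgA0 : 0 < gA := by rw [hgA]; positivity
  have hgB0 : 0 < gB := by rw [hgB]; exact div_pos (mul_pos hrB0 h2cs) (by norm_num)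
  have hgA2 : gA ^ 2 = ρA * (2 * c + s) ^ 2 / 9 := by rw [hgA, div_pow, mul_pow, hrA2]; ring
  have hgB2 : gB ^ 2 = ρB * (2 * c - s) ^ 2 / 9 := by rw [hgB, div_pow, mul_pow, hrB2]; ring
  have hΔA : delta M a Λ rA = 2 * rA * (gA - M) := by
    have e := delta_at_crit (M := M) hrA2 (by rw [← hℓ, ← hc]; exact hcritA)
    rw [e, ← hc, ← hℓ, hgA]
    have e2 : c - 2 * ℓ * ρA = (2 * c + s) / 3 := by rw [hρA]; field_simp; ring
    rw [e2, ← hrA2]; ring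
  have hΔB : delta M a Λ rB = 2 * rB * (gB - M) := by
    have e := delta_at_crit (M := M) hrB2 (by rw [← hℓ, ← hc]; exact hcritB)
    rw [e, ← hc, ← hℓ, hgB]
    have e2 : c - 2 * ℓ * ρB = (2 * c - s) / 3 := by rw [hρB]; field_simp; ring
    rw [e2, ← hrB2]; ring
  -- the key identity and the gap
  have hkey : M ^ 2 * subextremalDiscriminantHPV M a Λ = -(9 * Λ) * (M ^ 2 - gA ^ 2) * (M ^ 2 - gB ^ 2) := by
    rw [hgA2, hgB2, hρA, hρB, hc, hℓ]
    exact key_aux hM.ne' hΛ.ne' (by rw [hs2, hK, hc])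
  have hgap : gA ^ 2 < gB ^ 2 := by
    obtain ⟨-, -, hdiff⟩ := critvals_aux ℓ c s hℓ0.ne'
    rw [← hρA, ← hρB, ← hgA2, ← hgB2] at hdiff
    have : 0 < s ^ 3 / (27 * ℓ) := by positivity
    linarith
  -- hence gA < M < gB
  have hP : (M ^ 2 - gA ^ 2) * (M ^ 2 - gB ^ 2) < 0 := by
    have h1 : 0 < M ^ 2 * subextremalDiscriminantHPV M a Λ := by positivity
    rw [hkey, mul_assoc] at h1
    by_contra h
    rw [not_lt] at h
    have : -(9 * Λ) * ((M ^ 2 - gA ^ 2) * (M ^ 2 - gB ^ 2)) ≤ 0 :=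
      mul_nonpos_of_nonpos_of_nonneg (by linarith) h
    linarith
  have hMA : gA < M := by
    have h : gA ^ 2 < M ^ 2 := by
      by_contra h
      rw [not_lt] at h
      have : 0 ≤ (M ^ 2 - gA ^ 2) * (M ^ 2 - gB ^ 2) :=
        mul_nonneg_of_nonpos_of_nonpos (by linarith) (by linarith)
      linarith
    exact lt_of_pow_lt_pow_left₀ 2 hM.le h
  have hMB : M < gB := by
    have h : M ^ 2 < gB ^ 2 := by
      by_contra h
      rw [not_lt] at h
      have : 0 ≤ (M ^ 2 - gA ^ 2) * (M ^ 2 - gB ^ 2) := mul_nonneg (by linarith) (by linarith)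
      linarith
    exact lt_of_pow_lt_pow_left₀ 2 hgB0.le h
  refine ⟨rA, rB, hrA0, hrAB, ?_, ?_⟩
  · rw [hΔA]; exact mul_neg_of_pos_of_neg (by positivity) (by linarith)
  · rw [hΔB]; exact mul_pos (by positivity) (by linarith)

/-- **Step 2 (analysis + factorisation).** For `a ≠ 0`, `M, Λ > 0`, `D_HPV > 0`: three ordered
positive roots `0 < x < y < z` with `Δ_r = −(Λ/3)(r−x)(r−y)(r−z)(r+x+y+z)`.
[cite: HintzPetersenVasy2025, (1.2)] -/
theorem exists_factorisation_of_discriminantHPV_pos (hM : 0 < M) (hΛ : 0 < Λ) (ha : a ≠ 0)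
    (hD : 0 < subextremalDiscriminantHPV M a Λ) :
    ∃ x y z : ℝ, 0 < x ∧ x < y ∧ y < z ∧
      ∀ r, delta M a Λ r = -(Λ / 3) * (r - x) * (r - y) * (r - z) * (r + x + y + z) := by
  obtain ⟨rA, rB, hrA0, hrAB, hΔA, hΔB⟩ := exists_signChange_of_discriminantHPV_pos hM hΛ ha hD
  have hℓ0 : 0 < Λ / 3 := by positivity
  -- a far point where Δ_r < 0
  set R := rB + 1 + 3 / Λ with hR
  have h3Λ : 0 < 3 / Λ := by positivity
  have hRB : rB < R := by rw [hR]; linarith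
  have hΔR : delta M a Λ R < 0 := by
    have hR1 : 1 < R := by rw [hR]; linarith
    have hR0 : 0 < R := by linarith
    have hRℓ : 1 < Λ / 3 * R := by
      have : Λ / 3 * R = Λ / 3 * rB + Λ / 3 + 1 := by rw [hR]; field_simp
      rw [this]; nlinarith
    have hℓR2 : 1 < Λ / 3 * R ^ 2 := by nlinarith
    have h1 : (R ^ 2 + a ^ 2) * (1 - Λ / 3 * R ^ 2) < 0 :=
      mul_neg_of_pos_of_neg (by positivity) (by linarith)
    have h2 : 0 < 2 * M * R := by positivity
    unfold delta; linarith
  -- three roots by the intermediate value theorem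
  have hcont := delta_continuous' M a Λ
  have hΔ0 : 0 < delta M a Λ 0 := by
    have : delta M a Λ 0 = a ^ 2 := by unfold delta; ring
    rw [this]; positivity
  obtain ⟨x, hx, hzx⟩ : ∃ r ∈ Icc 0 rA, delta M a Λ r = 0 :=
    intermediate_value_Icc' hrA0.le hcont.continuousOn ⟨hΔA.le, hΔ0.le⟩
  obtain ⟨y, hy, hzy⟩ : ∃ r ∈ Icc rA rB, delta M a Λ r = 0 :=
    intermediate_value_Icc hrAB.le hcont.continuousOn ⟨hΔA.le, hΔB.le⟩
  obtain ⟨z, hz, hzz⟩ : ∃ r ∈ Icc rB R, delta M a Λ r = 0 :=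
    intermediate_value_Icc' hRB.le hcont.continuousOn ⟨hΔR.le, hΔB.le⟩
  have hx0 : 0 < x := by
    rcases hx.1.eq_or_lt with h | h
    · rw [← h] at hzx; linarith
    · exact h
  have hxA : x < rA := by
    rcases hx.2.lt_or_eq with h | h
    · exact h
    · rw [h] at hzx; linarith
  have hAy : rA < y := by
    rcases hy.1.eq_or_lt with h | h
    · rw [← h] at hzy; linarith
    · exact h
  have hyB : y < rB := by
    rcases hy.2.lt_or_eq with h | h
    · exact h
    · rw [h] at hzy; linarith
  have hBz : rB < z := by
    rcases hz.1.eq_or_lt with h | h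
    · rw [← h] at hzz; linarith
    · exact h
  have hxy : x < y := hxA.trans hAy
  have hyz : y < z := hyB.trans hBz
  -- Δ_r + (Λ/3)(r−x)(r−y)(r−z)(r+x+y+z) is a quadratic vanishing at x, y, z
  have hquad : ∀ r, delta M a Λ r + Λ / 3 * ((r - x) * (r - y) * (r - z) * (r + x + y + z)) =
      (1 - Λ * a ^ 2 / 3 + Λ / 3 * ((x * y + y * z + z * x) - (x + y + z) ^ 2)) * r ^ 2 +
        (-2 * M + Λ / 3 * ((x * y + y * z + z * x) * (x + y + z) - x * y * z)) * r +
        (a ^ 2 - Λ / 3 * (x * y * z) * (x + y + z)) := by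
    intro r; unfold delta; ring
  obtain ⟨e1, e2, e3⟩ := quad_eq_zero_of_three_roots hxy.ne hyz.ne (hxy.trans hyz).ne
    (by rw [← hquad, hzx]; ring) (by rw [← hquad, hzy]; ring) (by rw [← hquad, hzz]; ring)
  refine ⟨x, y, z, hx0, hxy, hyz, fun r => ?_⟩
  have h := hquad r
  rw [e1, e2, e3] at h
  linarith

/-- **`IsSubextremal ⇔ (M > 0, Λ > 0, D_HPV > 0)`** — the printed equivalence
[HintzPetersenVasy2025, (1.2)] between "`μ` has four distinct real roots" (here the tree's
`IsSubextremal`, see `isSubextremal_iff_factorisation`) and the discriminant condition.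
[cite: HintzPetersenVasy2025, (1.2)] -/
theorem isSubextremal_iff_discriminantHPV :
    IsSubextremal M a Λ ↔ 0 < M ∧ 0 < Λ ∧ 0 < subextremalDiscriminantHPV M a Λ := by
  constructor
  · exact fun h => ⟨h.1, h.2.1, subextremalDiscriminantHPV_pos h⟩
  · rintro ⟨hM, hΛ, hD⟩
    rcases eq_or_ne a 0 with ha | ha
    · subst ha
      rw [subextremalDiscriminantHPV_zero_a] at hD
      exact isSubextremal_zero_a_iff.2 ⟨hM, hΛ, by linarith⟩
    · obtain ⟨x, y, z, hx, hxy, hyz, hΔ⟩ := exists_factorisation_of_discriminantHPV_pos hM hΛ ha hD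
      exact (horizons_of_factorisation hM hΛ hx.le hxy hyz hΔ).1

/-- **`IsSubextremal ⇔ (M > 0, Λ > 0, (3.1))`** — Casals–Teixeira da Costa's printed standing
hypothesis `27M⁴ + L⁴(Ξ−1)Ξ⁴ + L²M²(Ξ−2)(−32+Ξ(32+Ξ)) < 0` is EQUIVALENT to the tree's `IsSubextremal`
(via `subextremalDiscriminantCTdC_eq`: `D_CTdC = −(3M²/Λ)·D_HPV`). [cite: CasalsTeixeiradacosta2022, (3.1)] -/
theorem isSubextremal_iff_discriminantCTdC :
    IsSubextremal M a Λ ↔ 0 < M ∧ 0 < Λ ∧ subextremalDiscriminantCTdC M a Λ < 0 := by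
  constructor
  · exact fun h => ⟨h.1, h.2.1, subextremalDiscriminantCTdC_neg h⟩
  · rintro ⟨hM, hΛ, hD⟩
    refine isSubextremal_iff_discriminantHPV.2 ⟨hM, hΛ, ?_⟩
    rw [subextremalDiscriminantCTdC_eq M a Λ hM.ne' hΛ.ne'] at hD
    have hpos : 0 < 3 * M ^ 2 / Λ := by positivity
    by_contra h
    rw [not_lt] at h
    have : 0 ≤ -(3 * M ^ 2 / Λ) * subextremalDiscriminantHPV M a Λ :=
      mul_nonneg_of_nonpos_of_nonpos (by linarith) h
    linarith

end IffDiscriminant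

end Literature.Geometry.Lorentzian.KerrDeSitter

end
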